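import Literature.AlgebraicGeometry.HodgeTheory.WeilClassesCyclicPrymOneClass
import HarnessLib

/-!
# Schoen's cyclic Prym fact in degree `3`: reduction to the two kernels

Topic `AlgebraicGeometry/HodgeTheory`; namespace `Literature.AlgebraicGeometry.HodgeTheory`.
Theorem-only companion (no definition, no named fact, sorry-free) of the named fact
`Literature.AlgebraicGeometry.HodgeTheory.Schoen1988_cyclicPrym_weilClasses_algebraic_degreeThree`
(`WeilClassesCyclicPrym.lean`; C. Schoen, Compositio Math. 65 (1988), Thm. 2.0 + Cor. 3.1 at
`(q, m, r) = (5, 3, 0)` = Patel–Zhang, arXiv:2506.13729, Thm 1.2 / Thm 5.3 with Lemma 5.1 at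
`G = ℤ/3`, `g(C') = 5`): for an étale `ℤ/3`-cover `C → C'` of a genus-`5` curve (`dim J(C) = 13`),
every class of the Weil plane `weilClassesOf P ψ₀ 4 3 = ⋀⁸ H¹_{ζ₃} ⊕ ⋀⁸ H¹_{ζ₃²}` of the Prym
EIGHTFOLD `P = (ker (𝟙 + α_* + α_*²))⁰`, `ψ₀ = 𝟙 + 2 s_P` (`ψ₀² = -3`), is algebraic.

Exactly as for the degree-`6` sibling (`WeilClassesCyclicPrymTyping/Dimension/Lefschetz/OneClass`),
the fact is PROVED here to follow from the two inputs the printed proof actually uses and the tree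
lacks:

* (i′) **`b₁(C(ℂ)) ≤ 2 dim J(C)` for the curve itself** — the open half of Milne, *Jacobian
  Varieties*, Prop. 2.1 (`dim J = g`), i.e. the per-curve kernel of the equivalent named facts
  `Motives.two_mul_dim_eq_finrank_bettiCohomology` / `Motives.isIso_bettiCohomology_map_abelJacobi`.
  It gives **`dim P = 8`** (`dim_kerComponent_cyclotomic₃_pushforward_eq_eight_of_finrank_le`):
  `2 dim P = dim ker (1 + S + S²)` on `H¹(J(ℂ); ℂ)` (`two_mul_dim_kerComponent_eq_finrank_ker`),
  `3 · dim ker Φ₃(S) = 2·26 - tr S - tr S²` (the projector `(2 - S - S²)/3`,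
  `three_mul_finrank_ker_cyclotomic₃`), `tr Sʲ = tr((α^*)ʲ | H¹(C))` through `(f^P)^*`
  (`trace_pow_complexBetti_map_pushforward_eq_of_finrank_le`), and
  `tr((α^*)ʲ | H¹(C)) = 2 - L(j)` with `L(1) + L(2) = 0` — the Lefschetz numbers of the free `α, α²`
  on the closed surface `C(ℂ)` vanish IN SUM by Smith theory + transfer
  (`lefschetz_sum_of_free_zmod_three`: `χ(M) = 3χ(M/⟨a⟩)`, Floyd / Bredon III.7.10, and
  `Σ_{g} L(g) = 3χ(M/⟨a⟩)`, Hatcher 3G.1; `tr(α^*|H²) = 1` as a rational cube root of unity) —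
  Patel–Zhang Lemma 2.9 / Lemma 5.1 (`dim B = (m-1)(g(C')-1) = 2·4`);
* (iii′) **ONE non-zero algebraic class in the Weil plane** `weilClassesOf P ψ₀ 4 3` (Schoen's cycle
  `z_χ`, Thm. 2.0 p. 13 / Cor. 3.1; Patel–Zhang Prop. 3.2, Thm 4.4 — symmetric powers, the
  Abel–Jacobi bundle, the class-field-theory square: NOT in the tree): the whole plane is then
  algebraic (`weilClassesOf_le_algebraicClasses_of_exists_mem`, from the degree-`6` file's
  `eigenspace_sup_eigenspace_le_algebraicClasses_of_exists`: eigen-components under `(2·𝟙 + ψ₀)^*`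
  are algebraic, a Weil line is spanned by one class, its conjugate spans the other).

Assemblies: `Schoen1988_cyclicPrym_weilClasses_algebraic_degreeThree_of_dim_eq_eight_of_exists`,
`…_of_finrank_le_of_exists_weilClass` (T₃ ⟸ (i′) ∧ (iii′)), `…_of_two_mul_dim_eq_of_exists_weilClass`,
`…_of_isIso_of_exists_weilClass`.

## References

* [Schoen1988HodgeWeil] C. Schoen, Compositio Math. 65 (1988): Lemma 1.5, Thm. 2.0 (p. 11, proof
  p. 13), §3 Cor. 3.1 (p. 24).
* [PatelZhang2025PrymHodge] D. Patel, Y. Zhang, arXiv:2506.13729 (2025): Lemma 2.9, Prop. 3.2,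
  Thm. 4.4, Lemma 5.1, Thm. 1.2 / 5.3.
* [Milne1986JacobianVarieties] J. S. Milne, *Jacobian Varieties* (1986): Prop. 2.1, Thm. 2.5.
* [Lange2023AbelianVarietiesC] H. Lange (2023), §4.1.1, Lemma 4.4.1, §4.5.2.
* [Bredon1972] G. Bredon, *Introduction to Compact Transformation Groups* (1972), Ch. III Thm. 7.10.
* [HatcherAT2002] A. Hatcher, *Algebraic Topology* (2002), §3.G Prop. 3G.1.
* [vanGeemen1994HodgeAV] B. van Geemen, LNM 1594 (1994), 4.9, proof of Lemma 5.2 (6).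
-/

noncomputable section

open Polynomial Module

namespace Literature.AlgebraicGeometry.HodgeTheory

/-! ### §1 Linear algebra: the multiplicity of the primitive cube roots of unity from two traces -/

section LinearAlgebra

variable {V : Type*} [AddCommGroup V] [Module ℂ V]

/-- `Φ₃ · (2 - X - X²) = (X + 2)(1 - X³)`. [folklore] -/
theorem cyclotomic₃_mul_threeIdempotent :
    ((X : ℂ[X]) ^ 2 + X + 1) * (2 - X - X ^ 2) = (X + 2) * (1 - X ^ 3) := by
  ring

/-- `2 - X - X² = -Φ₃ + 3`. [folklore] -/
theorem threeIdempotent_eq : (2 - X - X ^ 2 : ℂ[X]) = (-1) * (X ^ 2 + X + 1) + 3 := by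
  ring

/-- **The projector onto `ker Φ₃(T)` for `T³ = 1`**: `(2 - T - T²)/3 = 1 - (1 + T + T²)/3` (the sum of
the two primitive idempotents of `ℂ[ℤ/3]`) is a projection onto `ker (1 + T + T²)`. [folklore] -/
theorem isProj_ker_cyclotomic₃ (T : Module.End ℂ V) (hT : T ^ 3 = 1) :
    LinearMap.IsProj (LinearMap.ker (1 + T + T ^ 2)) ((3 : ℂ)⁻¹ • (2 - T - T ^ 2)) := by
  have hΦ : (1 + T + T ^ 2 : Module.End ℂ V) = aeval T ((X : ℂ[X]) ^ 2 + X + 1) := by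
    simp [map_add]; abel
  have hE : (2 - T - T ^ 2 : Module.End ℂ V) = aeval T (2 - X - X ^ 2 : ℂ[X]) := by
    simp [map_sub, map_ofNat]
  have h3 : aeval T (1 - (X : ℂ[X]) ^ 3) = 0 := by simp [hT]
  constructor
  · intro x
    rw [LinearMap.mem_ker, LinearMap.smul_apply, map_smul, hΦ, hE, ← Module.End.mul_apply,
      ← map_mul, cyclotomic₃_mul_threeIdempotent, map_mul, h3, mul_zero, LinearMap.zero_apply,
      smul_zero]
  · intro x hx
    rw [LinearMap.mem_ker, hΦ] at hx
    have h : (aeval T (2 - X - X ^ 2 : ℂ[X])) x = (3 : ℂ) • x := by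
      rw [threeIdempotent_eq, map_add, map_mul, LinearMap.add_apply, Module.End.mul_apply, hx,
        map_zero, zero_add, map_ofNat, Module.End.ofNat_apply, ← Nat.cast_smul_eq_nsmul ℂ,
        Nat.cast_ofNat]
    rw [LinearMap.smul_apply, hE, h, smul_smul, inv_mul_cancel₀ (by norm_num), one_smul]

/-- **`3 · dim ker (1 + T + T²) = 2 dim V - tr T - tr T²`** for `T³ = 1` on a finite-dimensional
complex vector space (character orthogonality for `ℤ/3`; the trace of the projector of
`isProj_ker_cyclotomic₃`). [folklore] -/
theorem three_mul_finrank_ker_cyclotomic₃ [FiniteDimensional ℂ V] (T : Module.End ℂ V)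
    (hT : T ^ 3 = 1) :
    (3 : ℂ) * Module.finrank ℂ (LinearMap.ker (1 + T + T ^ 2)) =
      2 * Module.finrank ℂ V - LinearMap.trace ℂ V T - LinearMap.trace ℂ V (T ^ 2) := by
  have h := (isProj_ker_cyclotomic₃ T hT).trace
  rw [map_smul, smul_eq_mul] at h
  have h' : LinearMap.trace ℂ V (2 - T - T ^ 2) =
      (3 : ℂ) * Module.finrank ℂ (LinearMap.ker (1 + T + T ^ 2)) := by
    rw [← h, ← mul_assoc, mul_inv_cancel₀ (by norm_num), one_mul]
  rw [← h']
  have h2 : (2 : Module.End ℂ V) = (2 : ℂ) • (1 : Module.End ℂ V) := by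
    ext x; simp [two_smul]
  rw [h2]
  simp only [map_sub, map_smul, LinearMap.trace_one, smul_eq_mul]

/-- **The count for the Prym eightfold.** If `T³ = 1`, `dim V = 26` and `tr Tʲ = 2 - L j` (`j = 1, 2`)
with `L 1 + L 2 = 0` — the traces on `H¹` of a free automorphism of order `3` of a closed surface of
genus `13`, `L j` its Lefschetz numbers — then `dim ker (1 + T + T²) = 16`.
[cite: PatelZhang2025PrymHodge, Lemma 2.9 and Lemma 5.1] -/
theorem finrank_ker_cyclotomic₃_eq_sixteen_of_sum [FiniteDimensional ℂ V] (T : Module.End ℂ V)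
    (hT : T ^ 3 = 1) (hV : Module.finrank ℂ V = 26) (L : ℕ → ℂ) (hL : L 1 + L 2 = 0)
    (htr : ∀ j : ℕ, 1 ≤ j → j ≤ 2 → LinearMap.trace ℂ V (T ^ j) = 2 - L j) :
    Module.finrank ℂ (LinearMap.ker (1 + T + T ^ 2)) = 16 := by
  have h := three_mul_finrank_ker_cyclotomic₃ T hT
  have t1 : LinearMap.trace ℂ V T = 2 - L 1 := by simpa using htr 1 le_rfl (by norm_num)
  rw [hV, t1, htr 2 (by norm_num) le_rfl] at h
  have h' : (3 : ℂ) * Module.finrank ℂ (LinearMap.ker (1 + T + T ^ 2)) = 3 * 16 := by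
    rw [h]; push_cast; linear_combination hL
  exact_mod_cast mul_left_cancel₀ (by norm_num : (3 : ℂ) ≠ 0) h'

end LinearAlgebra

end Literature.AlgebraicGeometry.HodgeTheory

/-! ### §2 Lefschetz numbers of a free `ℤ/3`-action on a closed manifold (Smith theory + transfer) -/

namespace Literature.AlgebraicGeometry.HodgeTheory

open CategoryTheory
open Literature.AlgebraicTopology.SingularHomology

universe u

section ZModThree

variable {M : Type u} [TopologicalSpace M]

/-- **`L(a) + L(a²) = 0` for a free homeomorphism `a` of order `3` of a closed manifold**, where
`L(aʲ) = Σ_k (-1)^k tr((a^*)ʲ | H^k(M; ℂ))`: `Σ_{j<3} L(aʲ) = 3 · χ(M/⟨a⟩)` by the transfer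
(`H^k(M/⟨a⟩; ℂ) = H^k(M; ℂ)^{⟨a⟩}` and the averaging projector, Hatcher Prop. 3G.1) while
`χ(M) = 3 · χ(M/⟨a⟩)` by Smith theory (Floyd; Bredon 1972 Ch. III Thm. 7.10, free case —
`OrbitSpace.euler_eq_prime_mul_euler`) and `L(1) = χ(M)`. No Lefschetz fixed point theorem is used.
[cite: Bredon1972, Ch. III Thm. 7.10] [cite: HatcherAT2002, §3.G Prop. 3G.1] -/
theorem lefschetz_sum_of_free_zmod_three {n : ℕ} [T2Space M] [CompactSpace M]
    [ChartedSpace (EuclideanSpace ℝ (Fin n)) M] [Nonempty M] (a : M ≃ₜ M) (ha : a ^ 3 = 1)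
    (h1 : ∀ x : M, a x ≠ x) :
    let L : ℕ → ℂ := fun j => ∑ k ∈ Finset.range (n + 1),
      (-1 : ℂ) ^ k * LinearMap.trace ℂ _ ((singularCohomology.map ℂ ℂ (a : C(M, M)) k).hom ^ j)
    L 1 + L 2 = 0 := by
  intro L
  haveI := ChartedSpace.locallyCompactSpace (EuclideanSpace ℝ (Fin n)) M
  haveI hfin : ∀ k, Module.Finite ℂ (singularCohomology ℂ ℂ M k) :=
    finite_singularCohomology_of_closedManifold ℂ n M
  haveI : Fact (Nat.Prime 3) := ⟨Nat.prime_three⟩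
  let A : ∀ k : ℕ, Module.End ℂ (singularCohomology ℂ ℂ M k) :=
    fun k => (singularCohomology.map ℂ ℂ (a : C(M, M)) k).hom
  have hApow : ∀ j k, (singularCohomology.map ℂ ℂ ((a ^ j : M ≃ₜ M) : C(M, M)) k).hom = A k ^ j :=
    fun j k => singularCohomology_map_homeomorph_pow_hom a j k
  have hA3 : ∀ k, A k ^ 3 = 1 := fun k => by
    rw [← hApow, ha]
    have hcoe : ((1 : M ≃ₜ M) : C(M, M)) = ContinuousMap.id M := rfl
    rw [hcoe, singularCohomology.map_id]
    rfl
  have hL : ∀ j, L j = ∑ k ∈ Finset.range (n + 1), (-1 : ℂ) ^ k * LinearMap.trace ℂ _ (A k ^ j) :=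
    fun j => rfl
  -- `a²` is fixed-point free as well: `a² x = x` gives `x = a³ x = a x`
  have h2 : ∀ x, (a ^ 2) x ≠ x := fun x hx => h1 x (by
    have : (a ^ 3) x = a x := by
      rw [show (3 : ℕ) = 1 + 2 from rfl, pow_add, Homeomorph.mul_apply, hx, pow_one]
    rw [ha, Homeomorph.one_apply] at this
    exact this.symm)
  have hfree : ∀ i : ℕ, 0 < i → i < 3 → ∀ x : M, (a ^ i) x ≠ x := by
    intro i hi0 hi3 x
    interval_cases i
    · rw [pow_one]; exact h1 x
    · exact h2 x
  -- Euler characteristics, and `L 0 = χ(M)`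
  have he := cast_eulerTrunc (n + 1)
  have hL0 : L 0 = (eulerTrunc (n + 1) M : ℂ) := by
    rw [he, hL]
    refine Finset.sum_congr rfl fun k _ => ?_
    rw [pow_zero, LinearMap.trace_one]
  -- Smith: `χ(M) = 3 χ(M/⟨a⟩)`
  have hE : (eulerTrunc (n + 1) M : ℂ) = 3 * (eulerTrunc (n + 1) (OrbitSpace a) : ℂ) := by
    have h := OrbitSpace.euler_eq_prime_mul_euler (n := n) a ha hfree
    change eulerTrunc (n + 1) M = (3 : ℕ) * eulerTrunc (n + 1) (OrbitSpace a) at h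
    exact_mod_cast h
  -- transfer + averaging: `3 χ(M/⟨a⟩) = L 0 + L 1 + L 2`
  have hS : (3 : ℂ) * (eulerTrunc (n + 1) (OrbitSpace a) : ℂ) = L 0 + L 1 + L 2 := by
    rw [he]
    have h := mul_euler_eq_sum_traces (N := n + 1) (m := 3) (fun k => singularCohomology ℂ ℂ M k)
      A hA3 three_ne_zero (fun k => Module.finrank ℂ (singularCohomology ℂ ℂ (OrbitSpace a) k))
      (fun k => by rw [OrbitSpace.finrank_cohomology_orbitSpace_eq a ha hfree k])
    rw [Nat.cast_ofNat] at h
    rw [h, Finset.sum_range_succ, Finset.sum_range_succ, Finset.sum_range_one, hL, hL, hL]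
  rw [← hE, ← hL0] at hS
  linear_combination -hS

end ZModThree

end Literature.AlgebraicGeometry.HodgeTheory

/-! ### §3 The curve: `L(α) + L(α²) = 0` and `tr(α^* | H²) = 1` for a free `α` of order `3` -/

namespace Literature.AlgebraicGeometry.HodgeTheory

open CategoryTheory AlgebraicGeometry
open Literature.AlgebraicTopology.SingularHomology Literature.AlgebraicGeometry.Motives

section Curve

variable {C : Motives.SchemeOver ℂ}

/-- `α³ = 𝟙` implies `α⁶ = 𝟙` (composition form). [folklore] -/
theorem comp_pow_six_of_comp_pow_three {α : C ⟶ C} (hα : α ≫ α ≫ α = 𝟙 C) :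
    α ≫ α ≫ α ≫ α ≫ α ≫ α = 𝟙 C := by
  rw [hα, Category.comp_id, hα]

/-- **The Lefschetz numbers of `α` and `α²` cancel** for a smooth projective complex curve `C` and an
automorphism `α` with `α³ = 𝟙` without fixed complex points:
`L(j) = tr((α^*)ʲ|H⁰) - tr((α^*)ʲ|H¹) + tr((α^*)ʲ|H²)` on `C(ℂ)` satisfy `L(1) + L(2) = 0` — by Smith
theory and the transfer on the closed surface `C(ℂ)` (`lefschetz_sum_of_free_zmod_three`), not by the
Lefschetz fixed point theorem. (Patel–Zhang Lemma 2.9: the Euler characteristic count on the quotient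
curve.) [cite: PatelZhang2025PrymHodge, Lemma 2.9] [cite: Bredon1972, Ch. III Thm. 7.10]
[cite: HatcherAT2002, §3.G Prop. 3G.1] -/
theorem lefschetz_sum_of_pow_three (hC : Motives.IsSmoothProjective 1 C) (α : C ⟶ C)
    (hα : α ≫ α ≫ α = 𝟙 C) (hfree : ∀ P : Motives.ComplexPoints C, P ≫ α ≠ P) :
    let L : ℕ → ℂ := fun j =>
      LinearMap.trace ℂ _ ((complexBetti.map α 0).hom ^ j) -
        LinearMap.trace ℂ _ ((complexBetti.map α 1).hom ^ j) +
        LinearMap.trace ℂ _ ((complexBetti.map α 2).hom ^ j)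
    L 1 + L 2 = 0 := by
  intro L
  letI := hC.chartedSpace
  haveI := Motives.ComplexPoints.compactSpace_of_isSmoothProjective hC
  haveI := Motives.ComplexPoints.t2Space_of_isSmoothProjective hC
  haveI : Nonempty (Motives.ComplexPoints C) := Motives.nonempty_algPoints_of_isSmoothProjective hC
  have hα6 := comp_pow_six_of_comp_pow_three hα
  set a := complexPointsHomeomorph α hα6 with ha_def
  have ha1 : ∀ x, a x = Motives.AlgPoints.map α x := fun x => rfl
  have ha2 : ∀ x, (a ^ 2) x = Motives.AlgPoints.map (α ≫ α) x := fun x =>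
    complexPointsHomeomorph_pow_apply α hα6 1 x α fun y => by rw [pow_one]; rfl
  have ha3 : a ^ 3 = 1 := by
    refine Homeomorph.ext fun x => ?_
    rw [complexPointsHomeomorph_pow_apply α hα6 2 x (α ≫ α) ha2, hα,
      Motives.AlgPoints.map_id_apply, Homeomorph.one_apply]
  have h1 : ∀ x, a x ≠ x := fun x hx => hfree x (by rw [ha1] at hx; exact hx)
  have h := lefschetz_sum_of_free_zmod_three (n := 2 * 1) a ha3 h1
  -- unfold the three-term sums
  have hsum : ∀ j : ℕ, (∑ k ∈ Finset.range (2 * 1 + 1), (-1 : ℂ) ^ k *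
      LinearMap.trace ℂ _ ((singularCohomology.map ℂ ℂ
        (a : C(Motives.ComplexPoints C, Motives.ComplexPoints C)) k).hom ^ j)) = L j := by
    intro j
    rw [show 2 * 1 + 1 = 3 from rfl, Finset.sum_range_succ, Finset.sum_range_succ, Finset.sum_range_one]
    change (-1 : ℂ) ^ 0 * LinearMap.trace ℂ _ ((complexBetti.map α 0).hom ^ j) +
      (-1 : ℂ) ^ 1 * LinearMap.trace ℂ _ ((complexBetti.map α 1).hom ^ j) +
      (-1 : ℂ) ^ 2 * LinearMap.trace ℂ _ ((complexBetti.map α 2).hom ^ j) = L j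
    simp only [L]
    ring
  simp only [hsum] at h
  exact h

/-- **`tr(α^* | H²(C(ℂ); ℂ)) = 1` for `α³ = 𝟙`**: the trace `l` on the line `H²` is a rational number
with `l³ = 1` (and `l² = 1`, `sq_trace_complexBetti_map_two_eq_one`). [folklore] -/
theorem trace_complexBetti_map_two_eq_one_of_pow_three (hC : Motives.IsSmoothProjective 1 C) (α : C ⟶ C)
    (hα : α ≫ α ≫ α = 𝟙 C) : LinearMap.trace ℂ _ (complexBetti.map α 2).hom = 1 := by
  haveI := finite_complexBetti_of_isSmoothProjective hC 2
  set l := LinearMap.trace ℂ _ (complexBetti.map α 2).hom with hl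
  have h3 : l ^ 3 = 1 := by
    rw [hl, ← trace_pow_complexBetti_map_two_of_curve hC α 3]
    have e : (complexBetti.map α 2).hom ^ 3 = (complexBetti.map (α ≫ α ≫ α) 2).hom := by
      simp only [complexBetti_map_comp_hom', pow_succ, pow_zero, Module.End.one_eq_id,
        LinearMap.id_comp, Module.End.mul_eq_comp, LinearMap.comp_assoc]
    rw [e, hα, complexBetti.map_id, ModuleCat.hom_id, ← Module.End.one_eq_id, LinearMap.trace_one,
      finrank_complexBetti_two_of_curve hC, Nat.cast_one]
  have h2 : l ^ 2 = 1 := sq_trace_complexBetti_map_two_eq_one hC α (comp_pow_six_of_comp_pow_three hα)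
  have h : l ^ 3 = l := by rw [pow_succ, h2, one_mul]
  rw [← h, h3]

end Curve

/-! ### §4 The Jacobian: `dim P = 8` from `b₁(C(ℂ)) ≤ 2 dim J` -/

section JacobianSide

variable {C : Motives.SchemeOver ℂ} (𝒥 : Jacobian C)

/-- `(g^*)` of `g = 𝟙 + s + s²` on `H¹` is `1 + S + S²`, `S = s^*`. [folklore] -/
theorem complexBetti_map_cyclotomic₃_one_hom {J : Motives.AbelianVariety ℂ} (s : J ⟶ J) :
    (complexBetti.map (𝟙 J + s + s ≫ s).hom.hom.hom 1).hom =
      1 + (complexBetti.map s.hom.hom.hom 1).hom + (complexBetti.map s.hom.hom.hom 1).hom ^ 2 := by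
  rw [complexBetti_map_add_one, complexBetti_map_add_one, complexBetti_map_comp_hom,
    ModuleCat.hom_add, ModuleCat.hom_add, ModuleCat.hom_comp]
  change (complexBetti.map (𝟙 J.X) 1).hom + _ + _ = _
  rw [complexBetti.map_id, ModuleCat.hom_id, ← Module.End.one_eq_id, pow_two, Module.End.mul_eq_comp]

/-- `(s^*)³ = 1` on `H¹` for `s³ = 𝟙`. [folklore] -/
theorem complexBetti_map_one_hom_pow_three {J : Motives.AbelianVariety ℂ} {s : J ⟶ J}
    (hs3 : s ≫ s ≫ s = 𝟙 J) : (complexBetti.map s.hom.hom.hom 1).hom ^ 3 = 1 := by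
  have h := congrArg (fun t : J ⟶ J => (complexBetti.map t.hom.hom.hom 1).hom) hs3
  dsimp only at h
  iterate 2 rw [complexBetti_map_comp_hom] at h
  simp only [ModuleCat.hom_comp] at h
  change _ = (complexBetti.map (𝟙 J.X) 1).hom at h
  rw [complexBetti.map_id, ModuleCat.hom_id, ← Module.End.one_eq_id] at h
  rw [← h]
  simp only [pow_succ, pow_zero, one_mul, Module.End.mul_eq_comp, LinearMap.comp_assoc]

/-- **`dim P = 8` for the Prym `P = (ker (𝟙 + α_* + α_*²))⁰` of an étale `ℤ/3`-cover with
`dim J(C) = 13`**, from the single inequality `b₁(C(ℂ)) ≤ 2 dim J` for the curve itself (the open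
half of Milne Prop. 2.1; the named facts `two_mul_dim_eq_finrank_bettiCohomology` /
`isIso_bettiCohomology_map_abelJacobi` supply it): Patel–Zhang Lemma 5.1
(`dim B = (m - 1)(g(C') - 1) = 2 · 4`) through the count `3·dim ker Φ₃ = 2·26 - tr S - tr S²`,
`tr Sʲ = tr((α^*)ʲ|H¹(C)) = 1 + 1 - L(j)`, `L(1) + L(2) = 0`.
[cite: PatelZhang2025PrymHodge, Lemma 2.9 and Lemma 5.1] [cite: Schoen1988HodgeWeil, Lemma 1.5]
[cite: Milne1986JacobianVarieties, §2 Prop. 2.1] -/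
theorem dim_kerComponent_cyclotomic₃_pushforward_eq_eight_of_finrank_le (α : C ⟶ C)
    (hC : Motives.IsSmoothProjective 1 C) (h13 : 𝒥.J.dim = 13)
    (hb : Module.finrank ℚ (Motives.bettiCohomology C 1) ≤ 2 * 𝒥.J.dim)
    (hα : α ≫ α ≫ α = 𝟙 C) (hfree : ∀ P : Motives.ComplexPoints C, P ≫ α ≠ P)
    {s : 𝒥.J ⟶ 𝒥.J} (hs : s = 𝒥.pushforward 𝒥 α) :
    (Motives.AbelianVariety.kerComponent (𝟙 𝒥.J + s + s ≫ s)).dim = 8 := by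
  haveI := finite_complexBetti_abelianVariety 𝒥.J 1
  set S := (complexBetti.map s.hom.hom.hom 1).hom with hSdef
  -- `2 dim P = dim ker (1 + S + S²)`
  have hD := two_mul_dim_kerComponent_eq_finrank_ker (𝟙 𝒥.J + s + s ≫ s)
  rw [complexBetti_map_cyclotomic₃_one_hom, ← hSdef] at hD
  -- `S³ = 1`, `dim H¹(J) = 26`
  have hS3 : S ^ 3 = 1 := complexBetti_map_one_hom_pow_three (pushforward_comp_pow_three_of_pow_three 𝒥 hα hs)
  have h26 : Module.finrank ℂ (complexBetti 𝒥.J.X 1) = 26 := by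
    rw [Motives.AbelianVariety.finrank_complexBetti_one, h13]
  -- the traces: `tr Sʲ = tr((α^*)ʲ|H¹(C)) = tr(H⁰) + tr(H²) - L j = 1 + 1 - L j`
  have hl : LinearMap.trace ℂ _ (complexBetti.map α 2).hom = 1 :=
    trace_complexBetti_map_two_eq_one_of_pow_three hC α hα
  have hL := lefschetz_sum_of_pow_three hC α hα hfree
  set L : ℕ → ℂ := fun j =>
    LinearMap.trace ℂ _ ((complexBetti.map α 0).hom ^ j) -
      LinearMap.trace ℂ _ ((complexBetti.map α 1).hom ^ j) +
      LinearMap.trace ℂ _ ((complexBetti.map α 2).hom ^ j) with hLdef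
  have htr : ∀ j : ℕ, 1 ≤ j → j ≤ 2 → LinearMap.trace ℂ _ (S ^ j) = 2 - L j := by
    intro j _ _
    rw [hSdef, hs, trace_pow_complexBetti_map_pushforward_eq_of_finrank_le 𝒥 hC hb α j]
    simp only [hLdef]
    rw [trace_pow_complexBetti_map_zero hC α j, trace_pow_complexBetti_map_two_of_curve hC α j, hl,
      one_pow]
    ring
  have h16 := finrank_ker_cyclotomic₃_eq_sixteen_of_sum S hS3 h26 L hL htr
  omega

/-- `dim P = 8` from the named fact `two_mul_dim_eq_finrank_bettiCohomology` (`2 dim J = b₁(C(ℂ))`,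
Milne Prop. 2.1). [cite: PatelZhang2025PrymHodge, Lemma 5.1] [cite: Milne1986JacobianVarieties, §2 Prop. 2.1] -/
theorem dim_kerComponent_cyclotomic₃_pushforward_eq_eight_of_two_mul_dim_eq
    (hT : Motives.two_mul_dim_eq_finrank_bettiCohomology) (α : C ⟶ C)
    (hC : Motives.IsSmoothProjective 1 C) (h13 : 𝒥.J.dim = 13)
    (hα : α ≫ α ≫ α = 𝟙 C) (hfree : ∀ P : Motives.ComplexPoints C, P ≫ α ≠ P)
    {s : 𝒥.J ⟶ 𝒥.J} (hs : s = 𝒥.pushforward 𝒥 α) :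
    (Motives.AbelianVariety.kerComponent (𝟙 𝒥.J + s + s ≫ s)).dim = 8 :=
  dim_kerComponent_cyclotomic₃_pushforward_eq_eight_of_finrank_le 𝒥 α hC h13 (hT C hC 𝒥).ge hα hfree hs

end JacobianSide

/-! ### §5 The Prym eightfold `(P, ψ₀)`: one algebraic Weil class suffices -/

section OneClass

variable {B : Motives.AbelianVariety ℂ} {ψ₀ : B ⟶ B}

/-- **One non-zero algebraic class in the Weil plane `weilClassesOf B ψ₀ 4 3` of an abelian eightfold
with `ψ₀² = -3` makes the whole plane algebraic** (the degree-`6` file's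
`eigenspace_sup_eigenspace_le_algebraicClasses_of_exists`, read through
`eigenspace_sup_eigenspace_eq_weilClassesOf`). [cite: Schoen1988HodgeWeil, §1 Lemma 1.2 and §2 p. 13 (proof of Thm. 2.0, case r = 0)]
[cite: vanGeemen1994HodgeAV, 4.9 and proof of Lemma 5.2 (6)] -/
theorem weilClassesOf_le_algebraicClasses_of_exists_mem (hdim : B.dim = 8)
    (hψ : ψ₀ ≫ ψ₀ = -(3 • 𝟙 B))
    (h : ∃ c ∈ weilClassesOf B ψ₀ 4 3, c ∈ algebraicClasses B.X 4 ∧ c ≠ 0) :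
    weilClassesOf B ψ₀ 4 3 ≤ algebraicClasses B.X 4 := by
  have hΛ := Motives.abelianVarietyCohomologyExteriorH1_holds.hasExteriorCohomologyH1 B
  rw [← eigenspace_sup_eigenspace_eq_weilClassesOf hΛ hψ] at h ⊢
  exact eigenspace_sup_eigenspace_le_algebraicClasses_of_exists hdim hψ h

/-- `ψ₀ ≫ ψ₀ = -(3 • 𝟙 P)` for `P = (ker Φ₃(s))⁰`, `ψ₀ = 𝟙 + 2 s_P`, in the Weil-class API shape
(`kerComponent_weilOperator_comp_self_of_cyclotomic₃` gives `(-3 : ℤ) • 𝟙`). [cite: Schoen1988HodgeWeil, §3 (p. 24)] -/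
theorem kerComponent_weilOperator_comp_self_of_cyclotomic₃' {J : Motives.AbelianVariety ℂ} {s : J ⟶ J}
    {sP ψ₀ : Motives.AbelianVariety.kerComponent (𝟙 J + s + s ≫ s) ⟶
      Motives.AbelianVariety.kerComponent (𝟙 J + s + s ≫ s)}
    (hsP : sP ≫ Motives.AbelianVariety.kerComponentι (𝟙 J + s + s ≫ s) =
      Motives.AbelianVariety.kerComponentι (𝟙 J + s + s ≫ s) ≫ s)
    (hψ₀ : ψ₀ = 𝟙 _ + 2 • sP) :
    ψ₀ ≫ ψ₀ = -(3 • 𝟙 _) := by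
  rw [kerComponent_weilOperator_comp_self_of_cyclotomic₃ hsP hψ₀, neg_zsmul, ofNat_zsmul]

end OneClass

/-! ### §6 Assemblies: the degree-`3` fact from its two kernels -/

section Assembly

/-- **What remains of the degree-`3` fact on the carriers: a DIMENSION and ONE CYCLE.** The named
fact `Schoen1988_cyclicPrym_weilClasses_algebraic_degreeThree` follows as soon as, for the same data,
(1) the Prym `P = (ker (𝟙 + α_* + α_*²))⁰` has dimension `8` (Patel–Zhang Lemma 5.1) and (2) its Weil
plane `weilClassesOf P ψ₀ 4 3` contains ONE non-zero algebraic class (Schoen's cycle, Thm. 2.0 /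
Cor. 3.1; Patel–Zhang Prop. 3.2–Thm. 4.4 — NOT in the tree).
[cite: Schoen1988HodgeWeil, Cor. 3.1 (p. 24) with Thm. 2.0 (p. 11)] [cite: PatelZhang2025PrymHodge, Lemma 5.1, Thm 4.4, Thm 5.3] -/
theorem Schoen1988_cyclicPrym_weilClasses_algebraic_degreeThree_of_dim_eq_eight_of_exists
    (h : ∀ (C : Motives.SchemeOver ℂ) (𝒥 : Jacobian C) (α : C ⟶ C),
      Motives.IsSmoothProjective 1 C → 𝒥.J.dim = 13 →
      α ≫ α ≫ α = 𝟙 C →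
      (∀ P : Motives.ComplexPoints C, P ≫ α ≠ P) →
    ∀ (s : 𝒥.J ⟶ 𝒥.J), s = 𝒥.pushforward 𝒥 α →
    ∀ (sP ψ₀ : Motives.AbelianVariety.kerComponent (𝟙 𝒥.J + s + s ≫ s) ⟶
        Motives.AbelianVariety.kerComponent (𝟙 𝒥.J + s + s ≫ s)),
      sP ≫ Motives.AbelianVariety.kerComponentι (𝟙 𝒥.J + s + s ≫ s) =
        Motives.AbelianVariety.kerComponentι (𝟙 𝒥.J + s + s ≫ s) ≫ s →
      ψ₀ = 𝟙 _ + 2 • sP →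
      (Motives.AbelianVariety.kerComponent (𝟙 𝒥.J + s + s ≫ s)).dim = 8 ∧
      ∃ c ∈ weilClassesOf (Motives.AbelianVariety.kerComponent (𝟙 𝒥.J + s + s ≫ s)) ψ₀ 4 3,
        c ∈ algebraicClasses (Motives.AbelianVariety.kerComponent (𝟙 𝒥.J + s + s ≫ s)).X 4 ∧ c ≠ 0) :
    Schoen1988_cyclicPrym_weilClasses_algebraic_degreeThree := by
  intro C 𝒥 α hC h13 hα hfree s hs sP ψ₀ hsP hψ₀ c hc
  obtain ⟨hdim, hex⟩ := h C 𝒥 α hC h13 hα hfree s hs sP ψ₀ hsP hψ₀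
  exact weilClassesOf_le_algebraicClasses_of_exists_mem hdim
    (kerComponent_weilOperator_comp_self_of_cyclotomic₃' hsP hψ₀) hex hc

/-- **The degree-`3` fact from its two kernels**: (i′) `b₁(C(ℂ)) ≤ 2 dim J(C)` for the curve itself
(the open half of Milne Prop. 2.1; gives `dim P = 8`,
`dim_kerComponent_cyclotomic₃_pushforward_eq_eight_of_finrank_le`) and (iii′) ONE non-zero algebraic
class in the Weil plane of `(P, ψ₀)` (Schoen's cycle — NOT in the tree).
[cite: Schoen1988HodgeWeil, Cor. 3.1 (p. 24) with Thm. 2.0 (p. 11, proof p. 13)]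
[cite: PatelZhang2025PrymHodge, Lemma 5.1, Thm 4.4, Thm 1.2 / 5.3] [cite: Milne1986JacobianVarieties, §2 Prop. 2.1] -/
theorem Schoen1988_cyclicPrym_weilClasses_algebraic_degreeThree_of_finrank_le_of_exists_weilClass
    (hb : ∀ (C : Motives.SchemeOver ℂ) (𝒥 : Jacobian C) (α : C ⟶ C),
      Motives.IsSmoothProjective 1 C → 𝒥.J.dim = 13 →
      α ≫ α ≫ α = 𝟙 C →
      (∀ P : Motives.ComplexPoints C, P ≫ α ≠ P) →
      Module.finrank ℚ (Motives.bettiCohomology C 1) ≤ 2 * 𝒥.J.dim)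
    (hZ : ∀ (C : Motives.SchemeOver ℂ) (𝒥 : Jacobian C) (α : C ⟶ C),
      Motives.IsSmoothProjective 1 C → 𝒥.J.dim = 13 →
      α ≫ α ≫ α = 𝟙 C →
      (∀ P : Motives.ComplexPoints C, P ≫ α ≠ P) →
    ∀ (s : 𝒥.J ⟶ 𝒥.J), s = 𝒥.pushforward 𝒥 α →
    ∀ (sP ψ₀ : Motives.AbelianVariety.kerComponent (𝟙 𝒥.J + s + s ≫ s) ⟶
        Motives.AbelianVariety.kerComponent (𝟙 𝒥.J + s + s ≫ s)),
      sP ≫ Motives.AbelianVariety.kerComponentι (𝟙 𝒥.J + s + s ≫ s) =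
        Motives.AbelianVariety.kerComponentι (𝟙 𝒥.J + s + s ≫ s) ≫ s →
      ψ₀ = 𝟙 _ + 2 • sP →
      ∃ c ∈ weilClassesOf (Motives.AbelianVariety.kerComponent (𝟙 𝒥.J + s + s ≫ s)) ψ₀ 4 3,
        c ∈ algebraicClasses (Motives.AbelianVariety.kerComponent (𝟙 𝒥.J + s + s ≫ s)).X 4 ∧ c ≠ 0) :
    Schoen1988_cyclicPrym_weilClasses_algebraic_degreeThree :=
  Schoen1988_cyclicPrym_weilClasses_algebraic_degreeThree_of_dim_eq_eight_of_exists
    fun C 𝒥 α hC h13 hα hfree s hs sP ψ₀ hsP hψ₀ =>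
      ⟨dim_kerComponent_cyclotomic₃_pushforward_eq_eight_of_finrank_le 𝒥 α hC h13
          (hb C 𝒥 α hC h13 hα hfree) hα hfree hs,
        hZ C 𝒥 α hC h13 hα hfree s hs sP ψ₀ hsP hψ₀⟩

/-- **The degree-`3` fact from `two_mul_dim_eq_finrank_bettiCohomology` and one algebraic Weil class.**
[cite: Milne1986JacobianVarieties, §2 Prop. 2.1 and Thm. 2.5] [cite: Schoen1988HodgeWeil, Cor. 3.1 (p. 24) with Thm. 2.0] -/
theorem Schoen1988_cyclicPrym_weilClasses_algebraic_degreeThree_of_two_mul_dim_eq_of_exists_weilClass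
    (hT : Motives.two_mul_dim_eq_finrank_bettiCohomology)
    (hZ : ∀ (C : Motives.SchemeOver ℂ) (𝒥 : Jacobian C) (α : C ⟶ C),
      Motives.IsSmoothProjective 1 C → 𝒥.J.dim = 13 →
      α ≫ α ≫ α = 𝟙 C →
      (∀ P : Motives.ComplexPoints C, P ≫ α ≠ P) →
    ∀ (s : 𝒥.J ⟶ 𝒥.J), s = 𝒥.pushforward 𝒥 α →
    ∀ (sP ψ₀ : Motives.AbelianVariety.kerComponent (𝟙 𝒥.J + s + s ≫ s) ⟶
        Motives.AbelianVariety.kerComponent (𝟙 𝒥.J + s + s ≫ s)),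
      sP ≫ Motives.AbelianVariety.kerComponentι (𝟙 𝒥.J + s + s ≫ s) =
        Motives.AbelianVariety.kerComponentι (𝟙 𝒥.J + s + s ≫ s) ≫ s →
      ψ₀ = 𝟙 _ + 2 • sP →
      ∃ c ∈ weilClassesOf (Motives.AbelianVariety.kerComponent (𝟙 𝒥.J + s + s ≫ s)) ψ₀ 4 3,
        c ∈ algebraicClasses (Motives.AbelianVariety.kerComponent (𝟙 𝒥.J + s + s ≫ s)).X 4 ∧ c ≠ 0) :
    Schoen1988_cyclicPrym_weilClasses_algebraic_degreeThree :=
  Schoen1988_cyclicPrym_weilClasses_algebraic_degreeThree_of_finrank_le_of_exists_weilClass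
    (fun C 𝒥 _ hC _ _ _ => (hT C hC 𝒥).ge) hZ

/-- **The degree-`3` fact from `isIso_bettiCohomology_map_abelJacobi` and one algebraic Weil class.**
[cite: Lange2023AbelianVarietiesC, §4.1.1 and Lemma 4.4.1] [cite: Schoen1988HodgeWeil, Cor. 3.1 (p. 24) with Thm. 2.0] -/
theorem Schoen1988_cyclicPrym_weilClasses_algebraic_degreeThree_of_isIso_of_exists_weilClass
    (hI : Motives.isIso_bettiCohomology_map_abelJacobi)
    (hZ : ∀ (C : Motives.SchemeOver ℂ) (𝒥 : Jacobian C) (α : C ⟶ C),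
      Motives.IsSmoothProjective 1 C → 𝒥.J.dim = 13 →
      α ≫ α ≫ α = 𝟙 C →
      (∀ P : Motives.ComplexPoints C, P ≫ α ≠ P) →
    ∀ (s : 𝒥.J ⟶ 𝒥.J), s = 𝒥.pushforward 𝒥 α →
    ∀ (sP ψ₀ : Motives.AbelianVariety.kerComponent (𝟙 𝒥.J + s + s ≫ s) ⟶
        Motives.AbelianVariety.kerComponent (𝟙 𝒥.J + s + s ≫ s)),
      sP ≫ Motives.AbelianVariety.kerComponentι (𝟙 𝒥.J + s + s ≫ s) =
        Motives.AbelianVariety.kerComponentι (𝟙 𝒥.J + s + s ≫ s) ≫ s →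
      ψ₀ = 𝟙 _ + 2 • sP →
      ∃ c ∈ weilClassesOf (Motives.AbelianVariety.kerComponent (𝟙 𝒥.J + s + s ≫ s)) ψ₀ 4 3,
        c ∈ algebraicClasses (Motives.AbelianVariety.kerComponent (𝟙 𝒥.J + s + s ≫ s)).X 4 ∧ c ≠ 0) :
    Schoen1988_cyclicPrym_weilClasses_algebraic_degreeThree :=
  Schoen1988_cyclicPrym_weilClasses_algebraic_degreeThree_of_two_mul_dim_eq_of_exists_weilClass
    (Motives.two_mul_dim_eq_finrank_bettiCohomology_of_isIso hI) hZ

end Assembly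

end Literature.AlgebraicGeometry.HodgeTheory

end
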